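/-
# Duality theory for digital nets: NRT weight, minimum distance and `(d, k, m, s)`-systems

[cite: DickPillichshammer2010, Ch. 7, §7.1–7.2] J. Dick, F. Pillichshammer, *Digital Nets and
Sequences*, Cambridge University Press 2010, Chapter 7 "Duality theory", Section 7.1
"`𝔽_b`-linear subspaces" (Definition 7.1, Definition 7.2, Proposition 7.3, Exercise 7.2) and
Section 7.2 "Duality theory for digital nets" (Definition 7.4, Theorem 7.5, Lemma 7.7, Theorem 7.8,
Corollary 7.9, Remark 7.11, Corollary 7.12).

The chapter relates the quality parameter `t` of a digital `(t, m, s)`-net generated by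
`C_1, …, C_s` to the minimum distance, with respect to the Niederreiter–Rosenbloom–Tsfasman (NRT)
weight `V_m`, of the dual space ("row space `𝒞` and its dual `𝒞^⊥`") of the generating matrices:
`t = m - δ_m(𝒞^⊥) + 1` (Corollary 7.9).

Conventions of this file.
* A vector `A = (𝐚_1, …, 𝐚_s) ∈ 𝔽_b^{sm}`, `𝐚_i ∈ 𝔽_b^m`, is a function `A : ι → Fin m → R`
  (`s = |ι|`, coordinates of `𝐚_i` indexed from `0`, so `v_m(𝐚) = 1 + max {j : a_j ≠ 0}` below).
  The weights are defined over any type with `0`; the book has `R = 𝔽_b`, here mostly a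
  commutative ring `R` (e.g. `ℤ_b`), a field where the proofs count (`b` prime).
* A system `{𝐜_j^{(i)} ∈ 𝔽_b^m : 1 ≤ j ≤ n, 1 ≤ i ≤ s}` is a function `c : ι → Fin n → M` with values
  in an `R`-module `M`; for generating matrices `C_1, …, C_s ∈ ℤ_b^{p × m}` of the tree
  (`C : ι → Matrix (Fin p) (Fin m) (ZMod b)`, points `digitalNetPoint C`, digital net condition
  `IsDigitalTMSNet`, linear independence parameter `linIndepParam`, cf.
  `Literature.Analysis.Quadrature.DigitalNetQualityParameter`) the system is that of the row
  vectors, `c = C` itself (`C i j ∈ ℤ_b^m` is the `j`-th row of `C_i`), with `n = p` rows per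
  matrix: this is the situation of [cite: DickPillichshammer2010, Rem. 7.11] (generating matrices
  with more rows than columns), which contains the square case `p = m` of Theorem 7.8.
* The dual space `𝒞^⊥ = {A ∈ 𝔽_b^{sn} : Σ_{i,j} a_{ij} 𝐜_j^{(i)} = 0}` of Theorem 7.5 is
  `dualSpace R c`, the kernel of `A ↦ Σ_{i,j} a_{ij} 𝐜_j^{(i)}`; for generating matrices it is the
  null space of `(C_1^⊤ | ⋯ | C_s^⊤)`, i.e. the digit-vector form of the dual net `dualNet C` of
  [cite: DickPillichshammer2010, Def. 4.76] (`Literature.Analysis.Quadrature.DigitalNets`), see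
  `digitVec_mem_dualSpace_iff` below.

What is not formalised here: Example 7.6 / 7.10 (a concrete `(0, 3, 2)`-net over `ℤ_2`),
Theorem 7.14 and Sections 7.3–7.4.
-/
import Mathlib
import Literature.Analysis.Quadrature.DigitalNetQualityParameter

open Finset

namespace Literature.Analysis.Quadrature

/-! ### Definition 7.1: the NRT weight -/

section Weight

variable {R : Type*} {m : ℕ}

section Zero

variable [Zero R]

open scoped Classical in
/-- **The weight `v_m(𝐚)` of `𝐚 = (a_1, …, a_m) ∈ 𝔽_b^m`**: `v_m(𝐚) = 0` if `𝐚 = 𝟎` and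
`v_m(𝐚) = max {j : 1 ≤ j ≤ m, a_j ≠ 0}` otherwise (coordinates indexed by `Fin m` from `0`, so
the weight is `1 +` the largest index of a non-zero coordinate).
[cite: DickPillichshammer2010, Def. 7.1] -/
noncomputable def vWeight (a : Fin m → R) : ℕ :=
  (univ.filter fun j => a j ≠ 0).sup fun j => (j : ℕ) + 1

/-- A non-zero coordinate lies below the weight: `a_j ≠ 0 ⟹ j ≤ v_m(𝐚)` (book indexing).
[cite: DickPillichshammer2010, Def. 7.1] -/
theorem lt_vWeight {a : Fin m → R} {j : Fin m} (h : a j ≠ 0) : (j : ℕ) < vWeight a := by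
  classical
  have : (j : ℕ) + 1 ≤ vWeight a :=
    Finset.le_sup (f := fun j : Fin m => (j : ℕ) + 1) (mem_filter.2 ⟨mem_univ _, h⟩)
  omega

/-- `v_m(𝐚) ≤ v` iff all coordinates `a_j` with `j > v` (book indexing) vanish.
[cite: DickPillichshammer2010, Def. 7.1] -/
theorem vWeight_le_iff {a : Fin m → R} {v : ℕ} :
    vWeight a ≤ v ↔ ∀ j : Fin m, v ≤ (j : ℕ) → a j = 0 := by
  classical
  unfold vWeight
  rw [Finset.sup_le_iff]
  constructor
  · intro h j hj
    by_contra hne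
    have := h j (mem_filter.2 ⟨mem_univ _, hne⟩)
    omega
  · intro h j hj
    have hne := (mem_filter.1 hj).2
    by_contra hlt
    exact hne (h j (by omega))

/-- Coordinates at or beyond the weight vanish. [cite: DickPillichshammer2010, Def. 7.1] -/
theorem apply_eq_zero_of_vWeight_le {a : Fin m → R} {j : Fin m} (h : vWeight a ≤ (j : ℕ)) :
    a j = 0 :=
  vWeight_le_iff.1 le_rfl j h

/-- `0 ≤ v_m(𝐚) ≤ m`. [cite: DickPillichshammer2010, Def. 7.1] -/
theorem vWeight_le (a : Fin m → R) : vWeight a ≤ m :=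
  vWeight_le_iff.2 fun j hj => absurd j.2 (not_lt.2 hj)

/-- `v_m(𝐚) = 0` iff `𝐚 = 𝟎`. [cite: DickPillichshammer2010, Def. 7.1] -/
theorem vWeight_eq_zero_iff {a : Fin m → R} : vWeight a = 0 ↔ a = 0 := by
  rw [← Nat.le_zero, vWeight_le_iff]
  exact ⟨fun h => funext fun j => h j (Nat.zero_le _), fun h j _ => by rw [h]; rfl⟩

/-- `v_m(𝟎) = 0`. [cite: DickPillichshammer2010, Def. 7.1] -/
@[simp] theorem vWeight_zero : vWeight (0 : Fin m → R) = 0 :=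
  vWeight_eq_zero_iff.2 rfl

/-- For `𝐚 ≠ 𝟎` the weight is attained: `v_m(𝐚) = j` for a coordinate `a_j ≠ 0` (book indexing).
[cite: DickPillichshammer2010, Def. 7.1] -/
theorem exists_vWeight_eq {a : Fin m → R} (h : a ≠ 0) :
    ∃ j : Fin m, a j ≠ 0 ∧ vWeight a = (j : ℕ) + 1 := by
  classical
  have hne : (univ.filter fun j => a j ≠ 0).Nonempty := by
    by_contra h0
    rw [Finset.not_nonempty_iff_eq_empty, Finset.filter_eq_empty_iff] at h0
    exact h (funext fun j => not_not.1 (h0 (mem_univ j)))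
  obtain ⟨j, hj, hsup⟩ := Finset.exists_mem_eq_sup _ hne fun j : Fin m => (j : ℕ) + 1
  exact ⟨j, (mem_filter.1 hj).2, hsup⟩

/-- `1 ≤ v_m(𝐚)` for `𝐚 ≠ 𝟎`. [cite: DickPillichshammer2010, Def. 7.1] -/
theorem vWeight_pos {a : Fin m → R} (h : a ≠ 0) : 0 < vWeight a :=
  Nat.pos_of_ne_zero fun h0 => h (vWeight_eq_zero_iff.1 h0)

end Zero

/-- `v_m(-𝐚) = v_m(𝐚)`. [cite: DickPillichshammer2010, Def. 7.1] [cite: DickPillichshammer2010, Ex. 7.2] -/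
@[simp] theorem vWeight_neg [AddGroup R] (a : Fin m → R) : vWeight (-a) = vWeight a := by
  refine le_antisymm (vWeight_le_iff.2 fun j hj => ?_) (vWeight_le_iff.2 fun j hj => ?_)
  · rw [Pi.neg_apply, apply_eq_zero_of_vWeight_le hj, neg_zero]
  · have := apply_eq_zero_of_vWeight_le hj
    rwa [Pi.neg_apply, neg_eq_zero] at this

/-- `v_m(𝐚 + 𝐛) ≤ max (v_m(𝐚), v_m(𝐛))`. [cite: DickPillichshammer2010, Def. 7.1]
[cite: DickPillichshammer2010, Ex. 7.2] -/
theorem vWeight_add_le [AddMonoid R] (a c : Fin m → R) :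
    vWeight (a + c) ≤ max (vWeight a) (vWeight c) :=
  vWeight_le_iff.2 fun j hj => by
    rw [Pi.add_apply, apply_eq_zero_of_vWeight_le (le_trans (le_max_left _ _) hj),
      apply_eq_zero_of_vWeight_le (le_trans (le_max_right _ _) hj), add_zero]

/-- `v_m(𝐚 - 𝐛) ≤ max (v_m(𝐚), v_m(𝐛))`. [cite: DickPillichshammer2010, Def. 7.1]
[cite: DickPillichshammer2010, Ex. 7.2] -/
theorem vWeight_sub_le [AddGroup R] (a c : Fin m → R) :
    vWeight (a - c) ≤ max (vWeight a) (vWeight c) := by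
  rw [sub_eq_add_neg]
  simpa only [vWeight_neg] using vWeight_add_le a (-c)

/-- `v_m(λ 𝐚) ≤ v_m(𝐚)`. [cite: DickPillichshammer2010, Def. 7.1] -/
theorem vWeight_smul_le [MulZeroClass R] (r : R) (a : Fin m → R) : vWeight (r • a) ≤ vWeight a :=
  vWeight_le_iff.2 fun j hj => by rw [Pi.smul_apply, smul_eq_mul, apply_eq_zero_of_vWeight_le hj, mul_zero]

variable {ι : Type*} [Fintype ι]

section Zero

variable [Zero R]

/-- **The NRT weight `V_m(A) = Σ_{i=1}^s v_m(𝐚_i)`** of `A = (𝐚_1, …, 𝐚_s) ∈ 𝔽_b^{sm}`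
(Niederreiter 1986, Rosenbloom–Tsfasman 1997). [cite: DickPillichshammer2010, Def. 7.1] -/
noncomputable def nrtWeight (A : ι → Fin m → R) : ℕ :=
  ∑ i, vWeight (A i)

/-- `V_m(A) = Σ_i v_m(𝐚_i)`. [cite: DickPillichshammer2010, Def. 7.1] -/
theorem nrtWeight_eq_sum (A : ι → Fin m → R) : nrtWeight A = ∑ i, vWeight (A i) := rfl

/-- `0 ≤ V_m(A) ≤ sm`. [cite: DickPillichshammer2010, Def. 7.1] -/
theorem nrtWeight_le (A : ι → Fin m → R) : nrtWeight A ≤ Fintype.card ι * m :=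
  calc nrtWeight A ≤ ∑ _i : ι, m := Finset.sum_le_sum fun i _ => vWeight_le (A i)
    _ = Fintype.card ι * m := by rw [Finset.sum_const, smul_eq_mul, Finset.card_univ]

/-- `V_m(A) = 0` iff `A = 𝟎`. [cite: DickPillichshammer2010, Def. 7.1]
[cite: DickPillichshammer2010, Ex. 7.2] -/
theorem nrtWeight_eq_zero_iff {A : ι → Fin m → R} : nrtWeight A = 0 ↔ A = 0 := by
  rw [nrtWeight, Finset.sum_eq_zero_iff]
  simp only [mem_univ, forall_const, vWeight_eq_zero_iff]
  exact ⟨fun h => funext h, fun h i => by rw [h]; rfl⟩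

/-- `V_m(𝟎) = 0`. [cite: DickPillichshammer2010, Def. 7.1] -/
@[simp] theorem nrtWeight_zero : nrtWeight (0 : ι → Fin m → R) = 0 :=
  nrtWeight_eq_zero_iff.2 rfl

/-- `1 ≤ V_m(A)` for `A ≠ 𝟎`. [cite: DickPillichshammer2010, Def. 7.1] -/
theorem nrtWeight_pos {A : ι → Fin m → R} (h : A ≠ 0) : 0 < nrtWeight A :=
  Nat.pos_of_ne_zero fun h0 => h (nrtWeight_eq_zero_iff.1 h0)

/-- `V_m(A) ≤ Σ_i u_i` as soon as `a_{ij} = 0` for `j > u_i` (book indexing), `i = 1, …, s`.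
[cite: DickPillichshammer2010, Def. 7.1] -/
theorem nrtWeight_le_sum {A : ι → Fin m → R} {u : ι → ℕ}
    (h : ∀ i (j : Fin m), u i ≤ (j : ℕ) → A i j = 0) : nrtWeight A ≤ ∑ i, u i :=
  Finset.sum_le_sum fun i _ => vWeight_le_iff.2 (h i)

end Zero

/-- `V_m(-A) = V_m(A)`. [cite: DickPillichshammer2010, Ex. 7.2] -/
@[simp] theorem nrtWeight_neg [AddGroup R] (A : ι → Fin m → R) : nrtWeight (-A) = nrtWeight A := by
  simp only [nrtWeight, Pi.neg_apply, vWeight_neg]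

/-- `V_m(A + B) ≤ V_m(A) + V_m(B)`. [cite: DickPillichshammer2010, Ex. 7.2] -/
theorem nrtWeight_add_le [AddMonoid R] (A B : ι → Fin m → R) :
    nrtWeight (A + B) ≤ nrtWeight A + nrtWeight B := by
  rw [nrtWeight, nrtWeight, nrtWeight, ← Finset.sum_add_distrib]
  exact Finset.sum_le_sum fun i _ =>
    le_trans (vWeight_add_le (A i) (B i)) (max_le (Nat.le_add_right _ _) (Nat.le_add_left _ _))

/-- `V_m(λ A) ≤ V_m(A)`. [cite: DickPillichshammer2010, Def. 7.1] -/
theorem nrtWeight_smul_le [MulZeroClass R] (r : R) (A : ι → Fin m → R) :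
    nrtWeight (r • A) ≤ nrtWeight A :=
  Finset.sum_le_sum fun i _ => vWeight_smul_le r (A i)

/-! ### Exercise 7.2: `d_m(A, B) = V_m(A - B)` is a metric on `𝔽_b^{sm}` -/

section Metric

variable [AddGroup R]

/-- `d_m(A, B) = V_m(A - B) = 0` iff `A = B`. [cite: DickPillichshammer2010, Ex. 7.2] -/
theorem nrtWeight_sub_eq_zero_iff {A B : ι → Fin m → R} : nrtWeight (A - B) = 0 ↔ A = B := by
  rw [nrtWeight_eq_zero_iff, sub_eq_zero]

/-- Symmetry: `d_m(A, B) = d_m(B, A)`. [cite: DickPillichshammer2010, Ex. 7.2] -/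
theorem nrtWeight_sub_comm (A B : ι → Fin m → R) : nrtWeight (A - B) = nrtWeight (B - A) := by
  rw [← nrtWeight_neg, neg_sub]

/-- Triangle inequality: `d_m(A, C) ≤ d_m(A, B) + d_m(B, C)`. [cite: DickPillichshammer2010, Ex. 7.2] -/
theorem nrtWeight_sub_le (A B C : ι → Fin m → R) :
    nrtWeight (A - C) ≤ nrtWeight (A - B) + nrtWeight (B - C) := by
  rw [← sub_add_sub_cancel A B C]
  exact nrtWeight_add_le _ _

end Metric

end Weight

/-! ### Definition 7.2: the minimum distance `δ_m(𝒩)` -/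

section MinDistance

variable {R : Type*} [AddGroup R] {ι : Type*} [Fintype ι] {m : ℕ}

open scoped Classical in
/-- **The minimum distance `δ_m(𝒩)`** of a subset `𝒩 ⊆ 𝔽_b^{sm}`:
`δ_m(𝒩) = min {V_m(A - B) : A, B ∈ 𝒩, A ≠ B}` if `|𝒩| ≥ 2`, and `δ_m(𝒩) = sm + 1` if `|𝒩| ≤ 1`
("for `|𝒩| = 1`"; also for `𝒩 = ∅` here). [cite: DickPillichshammer2010, Def. 7.2] -/
noncomputable def minDistance (N : Set (ι → Fin m → R)) : ℕ :=
  if ∃ A ∈ N, ∃ B ∈ N, A ≠ B then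
    sInf {δ : ℕ | ∃ A ∈ N, ∃ B ∈ N, A ≠ B ∧ nrtWeight (A - B) = δ}
  else Fintype.card ι * m + 1

/-- `δ_m(𝒩) ≤ V_m(A - B)` for `A ≠ B` in `𝒩`. [cite: DickPillichshammer2010, Def. 7.2] -/
theorem minDistance_le_nrtWeight_sub {N : Set (ι → Fin m → R)} {A B : ι → Fin m → R} (hA : A ∈ N)
    (hB : B ∈ N) (hAB : A ≠ B) : minDistance N ≤ nrtWeight (A - B) := by
  classical
  unfold minDistance
  rw [if_pos ⟨A, hA, B, hB, hAB⟩]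
  exact Nat.sInf_le ⟨A, hA, B, hB, hAB, rfl⟩

/-- For `|𝒩| ≥ 2` the minimum distance is attained. [cite: DickPillichshammer2010, Def. 7.2] -/
theorem exists_nrtWeight_sub_eq_minDistance {N : Set (ι → Fin m → R)}
    (h : ∃ A ∈ N, ∃ B ∈ N, A ≠ B) :
    ∃ A ∈ N, ∃ B ∈ N, A ≠ B ∧ nrtWeight (A - B) = minDistance N := by
  classical
  unfold minDistance
  rw [if_pos h]
  obtain ⟨A, hA, B, hB, hAB⟩ := h
  exact Nat.sInf_mem (⟨nrtWeight (A - B), A, hA, B, hB, hAB, rfl⟩ :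
    {δ : ℕ | ∃ A ∈ N, ∃ B ∈ N, A ≠ B ∧ nrtWeight (A - B) = δ}.Nonempty)

/-- `δ_m(𝒩) = sm + 1` for `|𝒩| ≤ 1`. [cite: DickPillichshammer2010, Def. 7.2] -/
theorem minDistance_of_subsingleton {N : Set (ι → Fin m → R)} (h : N.Subsingleton) :
    minDistance N = Fintype.card ι * m + 1 := by
  classical
  unfold minDistance
  rw [if_neg]
  rintro ⟨A, hA, B, hB, hAB⟩
  exact hAB (h hA hB)

/-- `δ_m({A}) = sm + 1`. [cite: DickPillichshammer2010, Def. 7.2] -/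
@[simp] theorem minDistance_singleton (A : ι → Fin m → R) :
    minDistance ({A} : Set (ι → Fin m → R)) = Fintype.card ι * m + 1 :=
  minDistance_of_subsingleton Set.subsingleton_singleton

/-- `1 ≤ δ_m(𝒩)`. [cite: DickPillichshammer2010, Def. 7.2] [cite: DickPillichshammer2010, Prop. 7.3] -/
theorem one_le_minDistance (N : Set (ι → Fin m → R)) : 1 ≤ minDistance N := by
  by_cases h : ∃ A ∈ N, ∃ B ∈ N, A ≠ B
  · obtain ⟨A, _, B, _, hAB, hδ⟩ := exists_nrtWeight_sub_eq_minDistance h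
    rw [← hδ]
    exact nrtWeight_pos (sub_ne_zero.2 hAB)
  · rw [minDistance_of_subsingleton fun A hA B hB => ?_]
    · exact Nat.succ_pos _
    · by_contra hAB
      exact h ⟨A, hA, B, hB, hAB⟩

/-- `δ_m(𝒩) ≤ sm + 1`. [cite: DickPillichshammer2010, Def. 7.2] -/
theorem minDistance_le (N : Set (ι → Fin m → R)) : minDistance N ≤ Fintype.card ι * m + 1 := by
  by_cases h : ∃ A ∈ N, ∃ B ∈ N, A ≠ B
  · obtain ⟨A, _, B, _, _, hδ⟩ := exists_nrtWeight_sub_eq_minDistance h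
    rw [← hδ]
    exact (nrtWeight_le _).trans (Nat.le_succ _)
  · rw [minDistance_of_subsingleton fun A hA B hB => ?_]
    by_contra hAB
    exact h ⟨A, hA, B, hB, hAB⟩

/-- For `|𝒩| ≥ 2`, `δ_m(𝒩) ≤ sm`. [cite: DickPillichshammer2010, Def. 7.2] -/
theorem minDistance_le_card_mul {N : Set (ι → Fin m → R)} (h : ∃ A ∈ N, ∃ B ∈ N, A ≠ B) :
    minDistance N ≤ Fintype.card ι * m := by
  obtain ⟨A, _, B, _, _, hδ⟩ := exists_nrtWeight_sub_eq_minDistance h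
  rw [← hδ]
  exact nrtWeight_le _

/-- Lower bounds: `δ ≤ δ_m(𝒩)` (`δ ≤ sm + 1`) iff `V_m(A - B) ≥ δ` for all `A ≠ B` in `𝒩`.
[cite: DickPillichshammer2010, Def. 7.2] -/
theorem le_minDistance_iff {N : Set (ι → Fin m → R)} {δ : ℕ} (hδ : δ ≤ Fintype.card ι * m + 1) :
    δ ≤ minDistance N ↔ ∀ A ∈ N, ∀ B ∈ N, A ≠ B → δ ≤ nrtWeight (A - B) := by
  constructor
  · exact fun h A hA B hB hAB => h.trans (minDistance_le_nrtWeight_sub hA hB hAB)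
  · intro h
    by_cases hN : ∃ A ∈ N, ∃ B ∈ N, A ≠ B
    · obtain ⟨A, hA, B, hB, hAB, hδ'⟩ := exists_nrtWeight_sub_eq_minDistance hN
      rw [← hδ']
      exact h A hA B hB hAB
    · rw [minDistance_of_subsingleton fun A hA B hB => ?_]
      · exact hδ
      · by_contra hAB
        exact hN ⟨A, hA, B, hB, hAB⟩

/-- **Linear case.** If `𝟎 ∈ 𝒩` then `δ_m(𝒩) ≤ V_m(A)` for every `A ∈ 𝒩 ∖ {𝟎}`.
[cite: DickPillichshammer2010, Def. 7.2] ("If `𝒩` is an `𝔽_b`-linear subspace …") -/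
theorem minDistance_le_nrtWeight {N : Set (ι → Fin m → R)} (h0 : (0 : ι → Fin m → R) ∈ N)
    {A : ι → Fin m → R} (hA : A ∈ N) (hA0 : A ≠ 0) : minDistance N ≤ nrtWeight A := by
  simpa only [sub_zero] using minDistance_le_nrtWeight_sub hA h0 hA0

/-- **Linear case**: for `𝒩` containing `𝟎` and closed under subtraction (e.g. an `𝔽_b`-linear
subspace), `δ_m(𝒩) = min {V_m(A) : A ∈ 𝒩 ∖ {𝟎}}`, i.e. `δ ≤ δ_m(𝒩)` (`δ ≤ sm + 1`) iff `V_m(A) ≥ δ`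
for all `A ∈ 𝒩 ∖ {𝟎}`. [cite: DickPillichshammer2010, Def. 7.2] -/
theorem le_minDistance_iff_of_sub_mem {N : Set (ι → Fin m → R)} (h0 : (0 : ι → Fin m → R) ∈ N)
    (hsub : ∀ A ∈ N, ∀ B ∈ N, A - B ∈ N) {δ : ℕ} (hδ : δ ≤ Fintype.card ι * m + 1) :
    δ ≤ minDistance N ↔ ∀ A ∈ N, A ≠ 0 → δ ≤ nrtWeight A := by
  rw [le_minDistance_iff hδ]
  constructor
  · intro h A hA hA0
    simpa only [sub_zero] using h A hA 0 h0 hA0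
  · intro h A hA B hB hAB
    exact h (A - B) (hsub A hA B hB) (sub_ne_zero.2 hAB)

/-- **Linear case**: the minimum distance of `𝒩 ∋ 𝟎`, closed under subtraction and `≠ {𝟎}`, is
attained as a weight `V_m(A)`, `A ∈ 𝒩 ∖ {𝟎}`. [cite: DickPillichshammer2010, Def. 7.2] -/
theorem exists_nrtWeight_eq_minDistance {N : Set (ι → Fin m → R)} (h0 : (0 : ι → Fin m → R) ∈ N)
    (hsub : ∀ A ∈ N, ∀ B ∈ N, A - B ∈ N) (hN : ∃ A ∈ N, A ≠ 0) :
    ∃ A ∈ N, A ≠ 0 ∧ nrtWeight A = minDistance N := by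
  obtain ⟨A, hA, hA0⟩ := hN
  obtain ⟨A', hA', B', hB', hne, hδ⟩ :=
    exists_nrtWeight_sub_eq_minDistance (N := N) ⟨A, hA, 0, h0, hA0⟩
  exact ⟨A' - B', hsub A' hA' B' hB', sub_ne_zero.2 hne, hδ⟩

end MinDistance

/-! ### Proposition 7.3: the Singleton-type bound `δ_m(𝒩) ≤ sm - h + 1` -/

section Singleton

variable {R : Type*} [AddGroup R] [Fintype R] {ι : Type*} [Fintype ι] {m : ℕ}

/-- Componentwise bounded integer vectors with prescribed sum: if `v_i ≤ cap_i` for all `i` and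
`Σ_i v_i + n ≤ Σ_i cap_i` then there is `e` with `v_i ≤ e_i ≤ cap_i` and `Σ_i e_i = Σ_i v_i + n`.
[folklore] -/
private theorem exists_between_sum_eq {ι : Type*} [Fintype ι] (cap : ι → ℕ) :
    ∀ (n : ℕ) (v : ι → ℕ), (∀ i, v i ≤ cap i) → ∑ i, v i + n ≤ ∑ i, cap i →
      ∃ e : ι → ℕ, (∀ i, v i ≤ e i) ∧ (∀ i, e i ≤ cap i) ∧ ∑ i, e i = ∑ i, v i + n := by
  classical
  intro n
  induction n with
  | zero => exact fun v hv _ => ⟨v, fun _ => le_rfl, hv, rfl⟩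
  | succ n ih =>
    intro v hv hsum
    -- some coordinate can still be increased
    obtain ⟨i, hi⟩ : ∃ i, v i < cap i := by
      by_contra h
      have : ∑ i, cap i ≤ ∑ i, v i := Finset.sum_le_sum fun i _ => not_lt.1 fun hi => h ⟨i, hi⟩
      omega
    let v' : ι → ℕ := Function.update v i (v i + 1)
    have hv'le : ∀ k, v k ≤ v' k := fun k => by
      rcases eq_or_ne k i with rfl | hk
      · simp [v']
      · simp [v', Function.update_of_ne hk]
    have hv'cap : ∀ k, v' k ≤ cap k := fun k => by
      rcases eq_or_ne k i with rfl | hk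
      · simpa [v'] using hi
      · simpa [v', Function.update_of_ne hk] using hv k
    have hv'sum : ∑ k, v' k = ∑ k, v k + 1 := by
      have h1 := Finset.sum_update_of_mem (mem_univ i) v (v i + 1)
      have h2 := Finset.sum_update_of_mem (mem_univ i) v (v i)
      rw [Function.update_eq_self] at h2
      simp only [v']
      omega
    obtain ⟨e, hve, hecap, hesum⟩ := ih v' hv'cap (by omega)
    exact ⟨e, fun k => (hv'le k).trans (hve k), hecap, by omega⟩

/-- Componentwise bounded integer vectors with prescribed sum: for `d ≤ Σ_i cap_i` there is
`e` with `e_i ≤ cap_i` and `Σ_i e_i = d`. [folklore] -/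
private theorem exists_le_sum_eq {ι : Type*} [Fintype ι] (cap : ι → ℕ) {d : ℕ} (hd : d ≤ ∑ i, cap i) :
    ∃ e : ι → ℕ, (∀ i, e i ≤ cap i) ∧ ∑ i, e i = d := by
  obtain ⟨e, -, hecap, hesum⟩ :=
    exists_between_sum_eq cap d (fun _ => 0) (fun _ => Nat.zero_le _) (by simpa using hd)
  exact ⟨e, hecap, by simpa using hesum⟩

/-- **Proposition 7.3 (pigeon-hole form).** If `𝒩 ⊆ 𝔽_b^{sm}` has more than `b^{h-1}` elements
(`h ≥ 1`, `b = |R|`), then `δ_m(𝒩) ≤ sm - h + 1`: two distinct elements of `𝒩` agree on any fixed set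
of `h - 1` coordinates, and choosing these to be the top coordinates of the blocks bounds the
weight of the difference. [cite: DickPillichshammer2010, Prop. 7.3] (proof: "`|π_h(𝒩)| < |𝒩|`
… `π_h(A) = π_h(B)` … `V_m(A - B) ≤ sm - h + 1`") -/
theorem minDistance_le_of_pow_lt_card (N : Finset (ι → Fin m → R)) {h : ℕ} (h1 : 1 ≤ h)
    (hN : Fintype.card R ^ (h - 1) < N.card) :
    minDistance (N : Set (ι → Fin m → R)) ≤ Fintype.card ι * m - h + 1 := by
  classical
  -- `h - 1 < sm` since `b^{h-1} < |𝒩| ≤ b^{sm}`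
  have hR : 1 ≤ Fintype.card R := Fintype.card_pos
  have hcardV : Fintype.card (ι → Fin m → R) = Fintype.card R ^ (Fintype.card ι * m) := by
    rw [Fintype.card_fun, Fintype.card_fun, Fintype.card_fin, ← pow_mul, mul_comm]
  have hle : h - 1 < Fintype.card ι * m := by
    by_contra hlt
    have h' : Fintype.card R ^ (Fintype.card ι * m) ≤ Fintype.card R ^ (h - 1) :=
      Nat.pow_le_pow_right hR (by omega)
    have : N.card ≤ Fintype.card R ^ (Fintype.card ι * m) := hcardV ▸ Finset.card_le_univ N
    omega
  -- block sizes `u_i ≤ m` with `Σ_i u_i = sm - (h - 1)`; the retained coordinates are `j ≥ u_i`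
  obtain ⟨u, hum, husum⟩ := exists_le_sum_eq (ι := ι) (fun _ => m)
    (d := Fintype.card ι * m - (h - 1))
    (by rw [Finset.sum_const, smul_eq_mul, Finset.card_univ]; omega)
  have hsum' : ∑ i, (m - u i) = h - 1 := by
    have h2 : ∑ i, (m - u i) + ∑ i, u i = ∑ _i : ι, m := by
      rw [← Finset.sum_add_distrib]
      exact Finset.sum_congr rfl fun i _ => Nat.sub_add_cancel (hum i)
    rw [Finset.sum_const, smul_eq_mul, Finset.card_univ, husum] at h2
    omega
  -- restriction to the top `m - u_i` coordinates of each block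
  let res : (ι → Fin m → R) → ((i : ι) → Fin (m - u i) → R) :=
    fun A i k => A i ⟨u i + k, by have := hum i; have := k.2; omega⟩
  have hcard : Fintype.card ((i : ι) → Fin (m - u i) → R) = Fintype.card R ^ (h - 1) := by
    rw [Fintype.card_pi]
    simp only [Fintype.card_fun, Fintype.card_fin]
    rw [Finset.prod_pow_eq_pow_sum, hsum']
  obtain ⟨x, y, hxy, hres⟩ := Fintype.exists_ne_map_eq_of_card_lt (fun A : N => res A.1)
    (by rw [hcard, Fintype.card_coe]; exact hN)
  have hAB : (x : ι → Fin m → R) ≠ (y : ι → Fin m → R) := fun heq => hxy (Subtype.ext heq)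
  -- `V_m(A - B) ≤ Σ_i u_i`
  have hw : nrtWeight ((x : ι → Fin m → R) - (y : ι → Fin m → R)) ≤ ∑ i, u i := by
    refine nrtWeight_le_sum fun i j hj => ?_
    have hk : (j : ℕ) - u i < m - u i := by have := j.2; omega
    have := congrFun (congrFun hres i) ⟨(j : ℕ) - u i, hk⟩
    have hj' : (⟨u i + ((j : ℕ) - u i), by have := hum i; omega⟩ : Fin m) = j :=
      Fin.ext (by simp only; omega)
    simp only [res, hj'] at this
    rw [Pi.sub_apply, Pi.sub_apply, this, sub_self]
  calc minDistance (N : Set (ι → Fin m → R))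
        ≤ nrtWeight ((x : ι → Fin m → R) - (y : ι → Fin m → R)) :=
        minDistance_le_nrtWeight_sub x.2 y.2 hAB
    _ ≤ ∑ i, u i := hw
    _ = Fintype.card ι * m - h + 1 := by rw [husum]; omega

/-- **Proposition 7.3.** For `𝒩 ⊆ 𝔽_b^{sm}` with `|𝒩| = b^h` (`b = |R| ≥ 2`):
`1 ≤ δ_m(𝒩) ≤ sm - h + 1`. [cite: DickPillichshammer2010, Prop. 7.3] -/
theorem minDistance_le_of_card_eq_pow (hR : 1 < Fintype.card R) (N : Finset (ι → Fin m → R))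
    {h : ℕ} (hN : N.card = Fintype.card R ^ h) :
    1 ≤ minDistance (N : Set (ι → Fin m → R)) ∧
      minDistance (N : Set (ι → Fin m → R)) ≤ Fintype.card ι * m - h + 1 := by
  refine ⟨one_le_minDistance _, ?_⟩
  rcases Nat.eq_zero_or_pos h with rfl | hpos
  · rw [pow_zero, Finset.card_eq_one] at hN
    obtain ⟨A, rfl⟩ := hN
    rw [Finset.coe_singleton, minDistance_singleton, Nat.sub_zero]
  · exact minDistance_le_of_pow_lt_card N hpos (hN ▸ Nat.pow_lt_pow_right hR (by omega))

/-- **Proposition 7.3, linear case.** For an `𝔽_b`-linear subspace `𝒩` of `𝔽_b^{sm}` (`𝔽_b` a finite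
field, more generally a finite division ring `K`): `1 ≤ δ_m(𝒩) ≤ sm - dim(𝒩) + 1`.
[cite: DickPillichshammer2010, Prop. 7.3] -/
theorem minDistance_le_of_finrank {K : Type*} [DivisionRing K] [Fintype K]
    (N : Submodule K (ι → Fin m → K)) :
    1 ≤ minDistance (N : Set (ι → Fin m → K)) ∧
      minDistance (N : Set (ι → Fin m → K)) ≤ Fintype.card ι * m - Module.finrank K N + 1 := by
  classical
  have hcard : (N : Set (ι → Fin m → K)).toFinset.card = Fintype.card K ^ Module.finrank K N := by
    rw [Set.toFinset_card, ← Module.card_eq_pow_finrank (K := K) (V := N)]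
    exact Fintype.card_congr (Equiv.refl _)
  have := minDistance_le_of_card_eq_pow (ι := ι) (m := m) Fintype.one_lt_card _ hcard
  rwa [Set.coe_toFinset] at this

end Singleton

/-! ### Definition 7.4 and Theorem 7.5: `(d, k, m, s)`-systems and the dual space -/

section System

variable {R : Type*} [CommRing R] {M : Type*} [AddCommGroup M] [Module R M]
  {ι : Type*} [Fintype ι] {n : ℕ}

/-- **`(d, k, m, s)`-systems over `𝔽_b`.** A system `{𝐜_j^{(i)} ∈ 𝔽_b^m : 1 ≤ j ≤ k, 1 ≤ i ≤ s}`
(`c : ι → Fin n → M`, `k = n` vectors per block, `s = |ι|` blocks, `𝔽_b^m` an `R`-module `M` here)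
is a `(d, k, m, s)`-system over `𝔽_b` if for any `d_1, …, d_s ∈ ℕ_0` with `0 ≤ d_i ≤ k` and
`Σ_{i=1}^s d_i = d` the system `{𝐜_j^{(i)} : 1 ≤ j ≤ d_i, 1 ≤ i ≤ s}` is linearly independent
("the empty system is considered linearly independent"); a `(d, m, s)`-system is a
`(d, m, m, s)`-system. [cite: DickPillichshammer2010, Def. 7.4] -/
def IsDSystem (R : Type*) [CommRing R] [Module R M] (d : ℕ) (c : ι → Fin n → M) : Prop :=
  ∀ (e : ι → ℕ) (he : ∀ i, e i ≤ n), ∑ i, e i = d →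
    LinearIndependent R fun x : (Σ i, Fin (e i)) => c x.1 (Fin.castLE (he x.1) x.2)

/-- The linear map `A = (a_{ij}) ↦ Σ_{i=1}^s Σ_{j=1}^k a_{ij} 𝐜_j^{(i)}` on `𝔽_b^{sk}` whose kernel is the
dual space `𝒞^⊥` of the system. [cite: DickPillichshammer2010, Thm. 7.5] (the defining relation of
`𝒞^⊥`) -/
def systemComb (R : Type*) [CommRing R] [Module R M] (c : ι → Fin n → M) : (ι → Fin n → R) →ₗ[R] M where
  toFun A := ∑ i, ∑ j, A i j • c i j
  map_add' A B := by
    simp only [Pi.add_apply, add_smul, Finset.sum_add_distrib]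
  map_smul' r A := by
    simp only [Pi.smul_apply, smul_eq_mul, RingHom.id_apply, Finset.smul_sum, smul_smul]

/-- `systemComb R c A = Σ_{i,j} a_{ij} 𝐜_j^{(i)}`. [cite: DickPillichshammer2010, Thm. 7.5] -/
@[simp] theorem systemComb_apply (c : ι → Fin n → M) (A : ι → Fin n → R) :
    systemComb R c A = ∑ i, ∑ j, A i j • c i j := rfl

/-- **The dual space `𝒞^⊥ ⊆ 𝔽_b^{sk}` of a system** `{𝐜_j^{(i)} : 1 ≤ j ≤ k, 1 ≤ i ≤ s}`:
`𝒞^⊥ = {A = (𝐚_1, …, 𝐚_s) : Σ_{i=1}^s Σ_{j=1}^k a_{ij} 𝐜_j^{(i)} = 𝟎}`; for the row vectors of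
generating matrices `C_1, …, C_s` it is the dual of the row space `𝒞` of `(C_1^⊤ | ⋯ | C_s^⊤)`, the null
space of that matrix. [cite: DickPillichshammer2010, Thm. 7.5] [cite: DickPillichshammer2010, Thm. 7.8]
-/
def dualSpace (R : Type*) [CommRing R] [Module R M] (c : ι → Fin n → M) : Submodule R (ι → Fin n → R) :=
  LinearMap.ker (systemComb R c)

/-- `A ∈ 𝒞^⊥ ⟺ Σ_{i,j} a_{ij} 𝐜_j^{(i)} = 𝟎`. [cite: DickPillichshammer2010, Thm. 7.5] -/
theorem mem_dualSpace {c : ι → Fin n → M} {A : ι → Fin n → R} :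
    A ∈ dualSpace R c ↔ ∑ i, ∑ j, A i j • c i j = 0 :=
  LinearMap.mem_ker

/-- Truncated sums over `Fin n`: if `f_j = 0` for `j ≥ e` (`e ≤ n`) then `Σ_{j < n} f_j = Σ_{j < e} f_j`.
[folklore] -/
private theorem sum_eq_sum_castLE {N : Type*} [AddCommMonoid N] {e n : ℕ} (h : e ≤ n) (f : Fin n → N)
    (hf : ∀ j : Fin n, e ≤ (j : ℕ) → f j = 0) : ∑ j, f j = ∑ j : Fin e, f (Fin.castLE h j) := by
  let g : ℕ → N := fun r => if hr : r < n then f ⟨r, hr⟩ else 0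
  have h1 : ∑ j : Fin n, f j = ∑ r ∈ range n, g r := by
    rw [← Fin.sum_univ_eq_sum_range]
    exact Finset.sum_congr rfl fun j _ => by simp only [g, dif_pos j.2]
  have h2 : ∑ j : Fin e, f (Fin.castLE h j) = ∑ r ∈ range e, g r := by
    rw [← Fin.sum_univ_eq_sum_range]
    exact Finset.sum_congr rfl fun j _ => by
      simp only [g, dif_pos (lt_of_lt_of_le j.2 h)]; rfl
  rw [h1, h2]
  symm
  refine Finset.sum_subset (Finset.range_subset_range.2 h) fun r hr hre => ?_
  have hrn : r < n := Finset.mem_range.1 hr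
  have her : e ≤ r := not_lt.1 fun h' => hre (Finset.mem_range.2 h')
  simp only [g, dif_pos hrn]
  exact hf ⟨r, hrn⟩ her

/-- **Theorem 7.5 (Niederreiter–Pirsic), "if".** If every `A ∈ 𝒞^⊥ ∖ {𝟎}` has NRT weight
`V_m(A) ≥ d + 1`, then the system is a `(d, k, m, s)`-system. [cite: DickPillichshammer2010, Thm. 7.5]
(proof, second half: "Suppose that `𝐜_1^{(i)}, …, 𝐜_{d_i}^{(i)}` are linearly dependent … put
`a_{ij} = 0` for `d_i < j ≤ k` … Then `V_m(A) ≤ d`") -/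
theorem isDSystem_of_le_nrtWeight {d : ℕ} {c : ι → Fin n → M}
    (h : ∀ A ∈ dualSpace R c, A ≠ 0 → d + 1 ≤ nrtWeight A) : IsDSystem R d c := by
  classical
  intro e he hed
  rw [Fintype.linearIndependent_iff]
  intro g hg x
  -- extend the coefficients by zero to `A = (a_{ij}) ∈ 𝔽_b^{sk}`
  let A : ι → Fin n → R := fun i j => if hj : (j : ℕ) < e i then g ⟨i, ⟨j, hj⟩⟩ else 0
  have hAcast : ∀ (i : ι) (j : Fin (e i)), A i (Fin.castLE (he i) j) = g ⟨i, j⟩ := fun i j => by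
    simp only [A, Fin.val_castLE, dif_pos j.2]
  have hAzero : ∀ (i : ι) (j : Fin n), e i ≤ (j : ℕ) → A i j = 0 := fun i j hj => by
    simp only [A, dif_neg (not_lt.2 hj)]
  have hAmem : A ∈ dualSpace R c := by
    rw [mem_dualSpace, ← hg, Fintype.sum_sigma]
    refine Finset.sum_congr rfl fun i _ => ?_
    rw [sum_eq_sum_castLE (he i) (fun j => A i j • c i j) fun j hj => by rw [hAzero i j hj, zero_smul]]
    exact Finset.sum_congr rfl fun j _ => by rw [hAcast]
  have hAw : nrtWeight A ≤ d := hed ▸ nrtWeight_le_sum hAzero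
  have hA0 : A = 0 := by
    by_contra hA0
    have := h A hAmem hA0
    omega
  rw [← hAcast x.1 x.2, hA0]
  rfl

/-- **Theorem 7.5 (Niederreiter–Pirsic), "only if".** If the system is a `(d, k, m, s)`-system
(`d ≤ sk`), then every `A ∈ 𝒞^⊥ ∖ {𝟎}` has `V_m(A) ≥ d + 1`. [cite: DickPillichshammer2010, Thm. 7.5]
(proof, first half: "`Σ_{i=1}^s v_m(𝐚_i) ≤ d` … by the assumed linear independence … `a_{ij} = 0`
for all `j` and `i`") -/
theorem IsDSystem.le_nrtWeight {d : ℕ} {c : ι → Fin n → M} (hc : IsDSystem R d c)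
    (hd : d ≤ Fintype.card ι * n) {A : ι → Fin n → R} (hA : A ∈ dualSpace R c) (hA0 : A ≠ 0) :
    d + 1 ≤ nrtWeight A := by
  classical
  by_contra hlt
  have hw : nrtWeight A ≤ d := by omega
  -- enlarge the profile `(v_m(𝐚_i))_i` to `d_1 + ⋯ + d_s = d`, `v_m(𝐚_i) ≤ d_i ≤ k`
  obtain ⟨e, hve, hen, hed⟩ := exists_between_sum_eq (fun _ : ι => n) (d - nrtWeight A)
    (fun i => vWeight (A i)) (fun i => vWeight_le (A i))
    (by rw [Finset.sum_const, smul_eq_mul, Finset.card_univ, ← nrtWeight_eq_sum]; omega)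
  rw [← nrtWeight_eq_sum] at hed
  have hli := Fintype.linearIndependent_iff.1 (hc e hen (by omega)) fun x => A x.1 (Fin.castLE (hen x.1) x.2)
  have hzero : ∀ (i : ι) (j : Fin n), e i ≤ (j : ℕ) → A i j = 0 := fun i j hj =>
    apply_eq_zero_of_vWeight_le ((hve i).trans hj)
  have hsum : ∑ x : (Σ i, Fin (e i)), A x.1 (Fin.castLE (hen x.1) x.2) • c x.1 (Fin.castLE (hen x.1) x.2) = 0 := by
    rw [← mem_dualSpace.1 hA, Fintype.sum_sigma]
    refine Finset.sum_congr rfl fun i _ => ?_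
    rw [sum_eq_sum_castLE (hen i) (fun j => A i j • c i j) fun j hj => by rw [hzero i j hj, zero_smul]]
  refine hA0 (funext fun i => funext fun j => ?_)
  by_cases hj : (j : ℕ) < e i
  · exact hli hsum ⟨i, ⟨j, hj⟩⟩
  · exact hzero i j (not_lt.1 hj)

/-- **Theorem 7.5 (Niederreiter and Pirsic).** The system `{𝐜_j^{(i)} ∈ 𝔽_b^m : 1 ≤ j ≤ k, 1 ≤ i ≤ s}`
is a `(d, k, m, s)`-system over `𝔽_b` (`d ≤ sk`) if and only if every `A ∈ 𝒞^⊥ ∖ {𝟎}` has NRT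
weight `V_m(A) ≥ d + 1`. [cite: DickPillichshammer2010, Thm. 7.5] -/
theorem isDSystem_iff_le_nrtWeight {d : ℕ} {c : ι → Fin n → M} (hd : d ≤ Fintype.card ι * n) :
    IsDSystem R d c ↔ ∀ A ∈ dualSpace R c, A ≠ 0 → d + 1 ≤ nrtWeight A :=
  ⟨fun hc _ hA hA0 => hc.le_nrtWeight hd hA hA0, isDSystem_of_le_nrtWeight⟩

/-- **Theorem 7.5 (Niederreiter and Pirsic).** The system `{𝐜_j^{(i)} ∈ 𝔽_b^m : 1 ≤ j ≤ k, 1 ≤ i ≤ s}`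
is a `(d, k, m, s)`-system over `𝔽_b` (`d ≤ sk`) if and only if the dual space `𝒞^⊥ ⊆ 𝔽_b^{sk}`
satisfies `δ_k(𝒞^⊥) ≥ d + 1`. [cite: DickPillichshammer2010, Thm. 7.5] -/
theorem isDSystem_iff_le_minDistance {d : ℕ} {c : ι → Fin n → M} (hd : d ≤ Fintype.card ι * n) :
    IsDSystem R d c ↔ d + 1 ≤ minDistance (dualSpace R c : Set (ι → Fin n → R)) := by
  rw [isDSystem_iff_le_nrtWeight hd, le_minDistance_iff_of_sub_mem (dualSpace R c).zero_mem
    (fun A hA B hB => (dualSpace R c).sub_mem hA hB) (by omega)]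
  rfl

/-- A `(d, k, m, s)`-system is a `(d', k, m, s)`-system for `d' ≤ d ≤ sk`.
[cite: DickPillichshammer2010, Def. 7.4] [cite: DickPillichshammer2010, Thm. 7.5] -/
theorem IsDSystem.mono {d d' : ℕ} {c : ι → Fin n → M} (hc : IsDSystem R d c)
    (hd : d ≤ Fintype.card ι * n) (hd' : d' ≤ d) : IsDSystem R d' c :=
  isDSystem_of_le_nrtWeight fun A hA hA0 => le_trans (by omega) (hc.le_nrtWeight hd hA hA0)

end System

/-! ### Dimension of the dual space and Corollary 7.12's linear algebra -/

section Field

variable {K : Type*} [Field K] {ι : Type*} [Fintype ι] {n m : ℕ}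

/-- `dim 𝔽_b^{sn} = sn`. [folklore] -/
private theorem finrank_blockSpace (K : Type*) [Field K] (ι : Type*) [Fintype ι] (n : ℕ) :
    Module.finrank K (ι → Fin n → K) = Fintype.card ι * n := by
  rw [Module.finrank_pi_fintype]
  simp only [Module.finrank_fin_fun, Finset.sum_const, smul_eq_mul, Finset.card_univ]

/-- **Dimension of the dual space**: for a system of `sn` vectors in `𝔽_b^m`,
`dim 𝒞^⊥ ≥ sn - m` ("the dimension of `𝒞` is at most `m`, and hence the dimension of `𝒞^⊥` is at
least `ms - m`"). [cite: DickPillichshammer2010, Cor. 7.9] (proof) -/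
theorem card_mul_le_finrank_dualSpace_add (c : ι → Fin n → (Fin m → K)) :
    Fintype.card ι * n ≤ Module.finrank K (dualSpace K c) + m := by
  have h1 := LinearMap.finrank_range_add_finrank_ker (systemComb K c)
  have h2 : Module.finrank K (LinearMap.range (systemComb K c)) ≤ m :=
    (Submodule.finrank_le _).trans (Module.finrank_fin_fun K).le
  rw [finrank_blockSpace] at h1
  unfold dualSpace
  omega

/-- Value of `A ↦ Σ_{i,j} a_{ij} 𝐜_j^{(i)}` on the unit vector `E_{ij}` (entry `y` at `(i, j)`):
`y 𝐜_j^{(i)}`. [cite: DickPillichshammer2010, Thm. 7.5] -/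
theorem systemComb_single {R : Type*} [CommRing R] {M : Type*} [AddCommGroup M] [Module R M]
    [DecidableEq ι] (c : ι → Fin n → M) (i : ι) (j : Fin n) (y : R) :
    systemComb R c (Pi.single i (Pi.single j y)) = y • c i j := by
  rw [systemComb_apply, Finset.sum_eq_single i, Finset.sum_eq_single j]
  · rw [Pi.single_eq_same, Pi.single_eq_same]
  · intro j' _ hj'
    rw [Pi.single_eq_same, Pi.single_eq_of_ne hj', zero_smul]
  · exact fun h => absurd (mem_univ j) h
  · intro i' _ hi'
    exact Finset.sum_eq_zero fun j' _ => by rw [Pi.single_eq_of_ne hi', Pi.zero_apply, zero_smul]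
  · exact fun h => absurd (mem_univ i) h

/-- A subspace of codimension at most `m` is the kernel of a linear map to `𝔽_b^m`. [folklore] -/
private theorem exists_ker_eq {V : Type*} [AddCommGroup V] [Module K V] [FiniteDimensional K V]
    (N : Submodule K V) (hN : Module.finrank K V ≤ Module.finrank K N + m) :
    ∃ L : V →ₗ[K] (Fin m → K), LinearMap.ker L = N := by
  have hq : Module.finrank K (V ⧸ N) ≤ m := by
    have := Submodule.finrank_quotient_add_finrank N
    omega
  let e := (Module.finBasis K (V ⧸ N)).equivFun
  let ext : (Fin (Module.finrank K (V ⧸ N)) → K) →ₗ[K] (Fin m → K) :=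
    Function.ExtendByZero.linearMap K (Fin.castLE hq)
  have hinj : Function.Injective ext := fun v w hvw => funext fun r => by
    have := congrFun hvw (Fin.castLE hq r)
    simpa only [ext, Function.ExtendByZero.linearMap_apply,
      (Fin.castLE_injective hq).extend_apply] using this
  refine ⟨ext ∘ₗ (e.toLinearMap ∘ₗ N.mkQ), ?_⟩
  rw [LinearMap.ker_comp_of_ker_eq_bot _ (LinearMap.ker_eq_bot.2 hinj),
    LinearMap.ker_comp_of_ker_eq_bot _ (LinearEquiv.ker e), Submodule.ker_mkQ]

/-- **Every subspace of codimension `≤ m` is a dual space**: for an `𝔽_b`-linear subspace `𝒩` of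
`𝔽_b^{sn}` with `dim 𝒩 ≥ sn - m` there is a system `{𝐜_j^{(i)} ∈ 𝔽_b^m : j ≤ n, i ≤ s}` (generating
matrices `C_1, …, C_s` with rows `𝐜_j^{(i)}`) whose dual space `𝒞^⊥` is `𝒩` ("the dual space … of `𝒩`
… has a generating matrix … `𝒩` is the dual of its row space").
[cite: DickPillichshammer2010, Cor. 7.12] (proof) -/
theorem exists_dualSpace_eq (N : Submodule K (ι → Fin n → K))
    (hN : Fintype.card ι * n ≤ Module.finrank K N + m) :
    ∃ c : ι → Fin n → (Fin m → K), dualSpace K c = N := by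
  classical
  obtain ⟨L, hL⟩ := exists_ker_eq N (by rwa [finrank_blockSpace])
  refine ⟨fun i j => L (Pi.single i (Pi.single j 1)), ?_⟩
  have hcomb : systemComb K (fun i j => L (Pi.single i (Pi.single j 1))) = L := by
    refine LinearMap.pi_ext fun i x => ?_
    have h := LinearMap.pi_ext (ι := Fin n) (φ := fun _ => K)
      (f := systemComb K (fun i j => L (Pi.single i (Pi.single j 1))) ∘ₗ
        LinearMap.single K (fun _ : ι => Fin n → K) i)
      (g := L ∘ₗ LinearMap.single K (fun _ : ι => Fin n → K) i) fun j y => by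
        simp only [LinearMap.coe_comp, Function.comp_apply, LinearMap.coe_single]
        rw [systemComb_single, ← map_smul, ← Pi.single_smul, ← Pi.single_smul, smul_eq_mul, mul_one]
    simpa only [LinearMap.coe_comp, Function.comp_apply, LinearMap.coe_single] using
      LinearMap.congr_fun h x
  unfold dualSpace
  rw [hcomb, hL]

end Field

/-! ### Lemma 7.7, Theorem 7.8, Corollary 7.9: digital nets and the dual of the row space -/

section DigitalNet

variable {b : ℕ} [NeZero b] {ι : Type*} [Fintype ι] {m p : ℕ}

omit [NeZero b] [Fintype ι] in
/-- The rows of the tree's linear systems, `genRow C j r` for `r < d_j ≤ p`, are the system vectors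
`𝐜_{r+1}^{(j)} = C j ⟨r, _⟩`. [folklore] -/
private theorem genRow_eq_castLE (C : ι → Matrix (Fin p) (Fin m) (ZMod b)) {e : ι → ℕ}
    (he : ∀ i, e i ≤ p) (x : Σ i, Fin (e i)) :
    genRow C x.1 (x.2 : ℕ) = C x.1 (Fin.castLE (he x.1) x.2) :=
  funext fun _ => dif_pos (lt_of_lt_of_le x.2.2 (he x.1))

omit [NeZero b] in
/-- **Lemma 7.7.** The matrices `C_1, …, C_s` generate a digital `(t, m, s)`-net (`0 ≤ t ≤ m`) if and
only if the system of their row vectors `{𝐜_j^{(i)} : 1 ≤ j ≤ p, 1 ≤ i ≤ s}` is an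
`(m - t, p, m, s)`-system (book: `p = m`, an `(m - t, m, s)`-system; here `C_i ∈ ℤ_b^{p × m}` with
`p ≥ m - t` as in Remark 7.11, over the ring `ℤ_b`). [cite: DickPillichshammer2010, Lemma 7.7]
[cite: DickPillichshammer2010, Rem. 7.11] -/
theorem isDigitalTMSNet_iff_isDSystem {t : ℕ} {C : ι → Matrix (Fin p) (Fin m) (ZMod b)}
    (hp : m ≤ p + t) : IsDigitalTMSNet t C ↔ t ≤ m ∧ IsDSystem (ZMod b) (m - t) C := by
  constructor
  · rintro ⟨htm, hC⟩
    refine ⟨htm, fun e he hed => ?_⟩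
    have h := hC e hed
    have hfun : (fun x : (Σ i, Fin (e i)) => genRow C x.1 (x.2 : ℕ)) =
        fun x => C x.1 (Fin.castLE (he x.1) x.2) := funext fun x => genRow_eq_castLE C he x
    rw [hfun] at h
    exact h
  · rintro ⟨htm, hC⟩
    refine ⟨htm, fun d hd => ?_⟩
    have hdp : ∀ j, d j ≤ p := fun j => by
      have := Finset.single_le_sum (fun j _ => Nat.zero_le (d j)) (mem_univ j)
      omega
    have h := hC d hdp hd
    have hfun : (fun x : (Σ i, Fin (d i)) => genRow C x.1 (x.2 : ℕ)) =
        fun x => C x.1 (Fin.castLE (hdp x.1) x.2) := funext fun x => genRow_eq_castLE C hdp x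
    rw [← hfun] at h
    exact h

/-- **Lemma 7.7, point form** (`b` prime): the digital point set of `C_1, …, C_s ∈ ℤ_b^{p × m}`,
`p ≥ m - t`, is a `(t, m, s)`-net in base `b` iff `t ≤ m` and the row vectors form an
`(m - t, p, m, s)`-system. [cite: DickPillichshammer2010, Lemma 7.7] [cite: DickPillichshammer2010, Rem. 7.11] -/
theorem isTMSNet_digitalNetPoint_iff_isDSystem [Fact b.Prime] {t : ℕ}
    {C : ι → Matrix (Fin p) (Fin m) (ZMod b)} (hp : m ≤ p + t) :
    IsTMSNet b t m (digitalNetPoint C) ↔ t ≤ m ∧ IsDSystem (ZMod b) (m - t) C := by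
  rw [← isDigitalTMSNet_iff_isTMSNet, isDigitalTMSNet_iff_isDSystem hp]

omit [NeZero b] in
/-- **Theorem 7.8.** The matrices `C_1, …, C_s` generate a digital `(t, m, s)`-net (`0 ≤ t ≤ m`,
`s ≥ 1`) if and only if the dual space `𝒞^⊥` of the row vectors satisfies `δ(𝒞^⊥) ≥ m - t + 1`
(book: `C_i ∈ ℤ_b^{m × m}` and `𝒞^⊥ ⊆ ℤ_b^{sm}` the null space of `(C_1^⊤ | ⋯ | C_s^⊤)`; here
`C_i ∈ ℤ_b^{p × m}` with `p ≥ m - t` and `𝒞^⊥ ⊆ ℤ_b^{sp}` as in Remark 7.11, over the ring `ℤ_b`).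
[cite: DickPillichshammer2010, Thm. 7.8] [cite: DickPillichshammer2010, Rem. 7.11] -/
theorem isDigitalTMSNet_iff_le_minDistance [Nonempty ι] {t : ℕ}
    {C : ι → Matrix (Fin p) (Fin m) (ZMod b)} (hp : m ≤ p + t) :
    IsDigitalTMSNet t C ↔
      t ≤ m ∧ m - t + 1 ≤ minDistance (dualSpace (ZMod b) C : Set (ι → Fin p → ZMod b)) := by
  have hd : m - t ≤ Fintype.card ι * p :=
    le_trans (by omega) (Nat.le_mul_of_pos_left p Fintype.card_pos)
  rw [isDigitalTMSNet_iff_isDSystem hp, isDSystem_iff_le_minDistance hd]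

/-- **Theorem 7.8, point form** (`b` prime): the digital point set of `C_1, …, C_s ∈ ℤ_b^{p × m}`,
`p ≥ m - t`, `s ≥ 1`, is a `(t, m, s)`-net in base `b` iff `t ≤ m` and `δ(𝒞^⊥) ≥ m - t + 1`.
[cite: DickPillichshammer2010, Thm. 7.8] [cite: DickPillichshammer2010, Rem. 7.11] -/
theorem isTMSNet_digitalNetPoint_iff_le_minDistance [Fact b.Prime] [Nonempty ι] {t : ℕ}
    {C : ι → Matrix (Fin p) (Fin m) (ZMod b)} (hp : m ≤ p + t) :
    IsTMSNet b t m (digitalNetPoint C) ↔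
      t ≤ m ∧ m - t + 1 ≤ minDistance (dualSpace (ZMod b) C : Set (ι → Fin p → ZMod b)) := by
  rw [← isDigitalTMSNet_iff_isTMSNet, isDigitalTMSNet_iff_le_minDistance hp]

omit [NeZero b] in
/-- **The linear independence parameter is `ρ = min(m, δ(𝒞^⊥) - 1)`** (`C_i ∈ ℤ_b^{p × m}`, `p ≥ m`,
`s ≥ 1`, any `b`): the combination of Theorem 7.8 with Theorem 4.52 (`t = m - ρ`) behind
Corollary 7.9. [cite: DickPillichshammer2010, Cor. 7.9] (proof) [cite: DickPillichshammer2010, Thm. 7.8] -/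
theorem linIndepParam_eq_min_minDistance [Nonempty ι] (C : ι → Matrix (Fin p) (Fin m) (ZMod b))
    (hp : m ≤ p) :
    linIndepParam C = min m (minDistance (dualSpace (ZMod b) C : Set (ι → Fin p → ZMod b)) - 1) := by
  have hδ1 := one_le_minDistance (dualSpace (ZMod b) C : Set (ι → Fin p → ZMod b))
  have hρm := linIndepParam_le C
  refine le_antisymm ?_ ?_
  · have hnet : IsDigitalTMSNet (m - linIndepParam C) C :=
      isDigitalTMSNet_iff_le.2 ⟨le_rfl, Nat.sub_le _ _⟩
    have := ((isDigitalTMSNet_iff_le_minDistance (by omega)).1 hnet).2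
    exact le_min hρm (by omega)
  · refine le_linIndepParam C (min_le_left _ _) fun d hd => ?_
    have hnet : IsDigitalTMSNet
        (m - min m (minDistance (dualSpace (ZMod b) C : Set (ι → Fin p → ZMod b)) - 1)) C :=
      (isDigitalTMSNet_iff_le_minDistance (by omega)).2 ⟨Nat.sub_le _ _, by omega⟩
    rw [systemMatrix_row]
    exact hnet.linearIndependent_of_le (by omega)

/-- **`δ(𝒞^⊥) ≤ m + 1`** for `b` prime: by Proposition 7.3, since `dim 𝒞^⊥ ≥ sp - m`.
[cite: DickPillichshammer2010, Cor. 7.9] (proof: "`δ_m(𝒞^⊥) ≤ m + 1`")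
[cite: DickPillichshammer2010, Prop. 7.3] -/
theorem minDistance_dualSpace_le [Fact b.Prime] (C : ι → Matrix (Fin p) (Fin m) (ZMod b)) :
    minDistance (dualSpace (ZMod b) C : Set (ι → Fin p → ZMod b)) ≤ m + 1 := by
  have h1 := (minDistance_le_of_finrank (dualSpace (ZMod b) C)).2
  have h2 := card_mul_le_finrank_dualSpace_add (K := ZMod b) C
  omega

/-- **`ρ(C_1, …, C_s) + 1 = δ(𝒞^⊥)`** for `b` prime, `C_i ∈ ℤ_b^{p × m}`, `p ≥ m`, `s ≥ 1`.
[cite: DickPillichshammer2010, Cor. 7.9] (proof) -/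
theorem linIndepParam_add_one_eq_minDistance [Fact b.Prime] [Nonempty ι]
    (C : ι → Matrix (Fin p) (Fin m) (ZMod b)) (hp : m ≤ p) :
    linIndepParam C + 1 = minDistance (dualSpace (ZMod b) C : Set (ι → Fin p → ZMod b)) := by
  have h1 := linIndepParam_eq_min_minDistance C hp
  have h2 := minDistance_dualSpace_le C
  have h3 := one_le_minDistance (dualSpace (ZMod b) C : Set (ι → Fin p → ZMod b))
  omega

/-- **Corollary 7.9.** For `b` prime, the digital net generated by `C_1, …, C_s ∈ ℤ_b^{p × m}`
(`p ≥ m`, `s ≥ 1`) is a `(t, m, s)`-net in base `b` if and only if `m - δ(𝒞^⊥) + 1 ≤ t ≤ m`: it is a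
strict digital `(m - δ(𝒞^⊥) + 1, m, s)`-net. [cite: DickPillichshammer2010, Cor. 7.9]
[cite: DickPillichshammer2010, Rem. 7.11] -/
theorem isTMSNet_digitalNetPoint_iff_minDistance [Fact b.Prime] [Nonempty ι] {t : ℕ}
    {C : ι → Matrix (Fin p) (Fin m) (ZMod b)} (hp : m ≤ p) :
    IsTMSNet b t m (digitalNetPoint C) ↔
      m + 1 - minDistance (dualSpace (ZMod b) C : Set (ι → Fin p → ZMod b)) ≤ t ∧ t ≤ m := by
  rw [isTMSNet_digitalNetPoint_iff_le]
  have := linIndepParam_add_one_eq_minDistance C hp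
  constructor <;> rintro ⟨h1, h2⟩ <;> exact ⟨by omega, h2⟩

/-- **Corollary 7.9, the attained value**: for `b` prime the digital net generated by
`C_1, …, C_s ∈ ℤ_b^{p × m}` (`p ≥ m`, `s ≥ 1`) is an `(m - δ(𝒞^⊥) + 1, m, s)`-net in base `b`.
[cite: DickPillichshammer2010, Cor. 7.9] -/
theorem isTMSNet_digitalNetPoint_sub_minDistance [Fact b.Prime] [Nonempty ι]
    (C : ι → Matrix (Fin p) (Fin m) (ZMod b)) (hp : m ≤ p) :
    IsTMSNet b (m + 1 - minDistance (dualSpace (ZMod b) C : Set (ι → Fin p → ZMod b))) m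
      (digitalNetPoint C) :=
  (isTMSNet_digitalNetPoint_iff_minDistance hp).2 ⟨le_rfl, by
    have := one_le_minDistance (dualSpace (ZMod b) C : Set (ι → Fin p → ZMod b)); omega⟩

/-- **Corollary 7.9, strictness** (any `b`): the digital net generated by `C_1, …, C_s ∈ ℤ_b^{p × m}`
(`p ≥ m`, `s ≥ 1`) is not a `(t, m, s)`-net in base `b` for `t < m - δ(𝒞^⊥) + 1`.
[cite: DickPillichshammer2010, Cor. 7.9] [cite: DickPillichshammer2010, Thm. 4.52] -/
theorem not_isTMSNet_digitalNetPoint_of_lt_sub_minDistance [Nonempty ι] {t : ℕ}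
    {C : ι → Matrix (Fin p) (Fin m) (ZMod b)} (hp : m ≤ p)
    (ht : t < m + 1 - minDistance (dualSpace (ZMod b) C : Set (ι → Fin p → ZMod b))) :
    ¬ IsTMSNet b t m (digitalNetPoint C) := by
  have h1 : linIndepParam C ≤ minDistance (dualSpace (ZMod b) C : Set (ι → Fin p → ZMod b)) - 1 :=
    (linIndepParam_eq_min_minDistance C hp).le.trans (min_le_right _ _)
  have h2 := one_le_minDistance (dualSpace (ZMod b) C : Set (ι → Fin p → ZMod b))
  exact not_isTMSNet_digitalNetPoint_of_lt (by omega)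

/-- **Corollary 7.12.** Let `m, s ≥ 1` and `b` prime. From any `𝔽_b`-linear subspace `𝒩` of
`𝔽_b^{sm}` with `dim 𝒩 ≥ ms - m` one obtains generating matrices `C_1, …, C_s ∈ ℤ_b^{m × m}` with
`𝒞^⊥ = 𝒩`, hence `ρ(C_1, …, C_s) = δ_m(𝒩) - 1` and a strict digital `(t, m, s)`-net over `ℤ_b` with
`t = m - δ_m(𝒩) + 1` (the book assumes `s ≥ 2`). [cite: DickPillichshammer2010, Cor. 7.12] -/
theorem exists_digitalNet_dualSpace_eq [Fact b.Prime] [Nonempty ι]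
    (N : Submodule (ZMod b) (ι → Fin m → ZMod b))
    (hN : Fintype.card ι * m ≤ Module.finrank (ZMod b) N + m) :
    ∃ C : ι → Matrix (Fin m) (Fin m) (ZMod b), dualSpace (ZMod b) C = N ∧
      linIndepParam C + 1 = minDistance (N : Set (ι → Fin m → ZMod b)) ∧
      ∀ t : ℕ, IsTMSNet b t m (digitalNetPoint C) ↔
        m + 1 - minDistance (N : Set (ι → Fin m → ZMod b)) ≤ t ∧ t ≤ m := by
  obtain ⟨C, hC⟩ := exists_dualSpace_eq N hN
  refine ⟨C, hC, ?_, fun t => ?_⟩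
  · rw [← hC]
    exact linIndepParam_add_one_eq_minDistance C le_rfl
  · rw [← hC]
    exact isTMSNet_digitalNetPoint_iff_minDistance le_rfl

end DigitalNet

/-! ### Theorem 7.8 in terms of the dual net `𝓓(C_1, …, C_s) ⊆ ℕ_0^s` -/

section DualNet

variable {b : ℕ} [NeZero b] {ι : Type*} [Fintype ι] {m p : ℕ}

omit [NeZero b] [Fintype ι] in
/-- `C^⊤ 𝐯 = Σ_r v_r 𝐜_r` (rows `𝐜_r` of `C`). [folklore] -/
private theorem transpose_mulVec_eq_sum_smul (A : Matrix (Fin p) (Fin m) (ZMod b)) (v : Fin p → ZMod b) :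
    (Matrix.transpose A).mulVec v = ∑ r, v r • A r := by
  funext c
  simp only [Matrix.mulVec, dotProduct, Matrix.transpose_apply, Finset.sum_apply, Pi.smul_apply,
    smul_eq_mul]
  exact Finset.sum_congr rfl fun r _ => mul_comm _ _

omit [NeZero b] in
/-- **The dual space of the row vectors is the digit form of the dual net**: for `𝐤 ∈ ℕ_0^s` the
block vector of truncated digit vectors `(tr_p(⃗k_1), …, tr_p(⃗k_s)) ∈ ℤ_b^{sp}` lies in `𝒞^⊥` iff
`C_1^⊤ tr_p(⃗k_1) + ⋯ + C_s^⊤ tr_p(⃗k_s) = 𝟎`, i.e. iff `𝐤 ∈ 𝓓(C_1, …, C_s)`.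
[cite: DickPillichshammer2010, Thm. 7.8] (`𝒞^⊥` "is the null space of `C`")
[cite: DickPillichshammer2010, Def. 4.76] -/
theorem digitVec_mem_dualSpace_iff (C : ι → Matrix (Fin p) (Fin m) (ZMod b)) (k : ι → ℕ) :
    (fun j => digitVec b p (k j)) ∈ dualSpace (ZMod b) C ↔ k ∈ dualNet C := by
  simp only [mem_dualSpace, mem_dualNet, transpose_mulVec_eq_sum_smul]

omit [NeZero b] in
/-- `digitLen b k = 0 ↔ k = 0`. [folklore] -/
private theorem digitLen_eq_zero_iff' {k : ℕ} : digitLen b k = 0 ↔ k = 0 := by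
  unfold digitLen; split_ifs with h <;> simp [h]

omit [NeZero b] in
/-- **The weight of a digit vector is the digit length**: for `0 ≤ k < b^p` (`b ≥ 2`) the weight
`v_p(tr_p(⃗k))` of the digit vector `(κ_0, …, κ_{p-1})` is the number of base-`b` digits of `k`
(`κ_{ℓ-1} ≠ 0 = κ_ℓ = κ_{ℓ+1} = ⋯` for `b^{ℓ-1} ≤ k < b^ℓ`). [cite: DickPillichshammer2010, Def. 7.1]
[cite: DickPillichshammer2010, Thm. 13.6] (`k_i` "has `ℓ_i` digits") -/
theorem vWeight_digitVec (hb : 1 < b) {k : ℕ} (hk : k < b ^ p) :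
    vWeight (digitVec b p k) = digitLen b k := by
  rcases eq_or_ne k 0 with rfl | hk0
  · rw [digitLen_eq_zero_iff'.2 rfl, vWeight_eq_zero_iff]
    funext r
    simp [digitVec, natDigit]
  have hL : digitLen b k = Nat.log b k + 1 := if_neg hk0
  have hlow : b ^ (digitLen b k - 1) ≤ k := by rw [hL, Nat.add_sub_cancel]; exact Nat.pow_log_le_self b hk0
  have hup : k < b ^ digitLen b k := by rw [hL]; exact Nat.lt_pow_succ_log_self hb k
  have hLp : digitLen b k ≤ p := by
    by_contra h
    have : b ^ p ≤ b ^ (digitLen b k - 1) := Nat.pow_le_pow_right (by omega) (by omega)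
    omega
  refine le_antisymm (vWeight_le_iff.2 fun r hr => ?_) ?_
  · -- digits from position `ℓ` on vanish
    have hkr : k < b ^ (r : ℕ) := lt_of_lt_of_le hup (Nat.pow_le_pow_right (by omega) hr)
    simp [digitVec, natDigit, Nat.div_eq_of_lt hkr]
  · -- the digit at position `ℓ - 1` is non-zero
    have hL1 : 1 ≤ digitLen b k := by rw [hL]; omega
    have hq : k / b ^ (digitLen b k - 1) < b := by
      rw [Nat.div_lt_iff_lt_mul (by positivity), ← pow_succ', Nat.sub_add_cancel hL1]
      exact hup
    have hq1 : 1 ≤ k / b ^ (digitLen b k - 1) := (Nat.le_div_iff_mul_le (by positivity)).2 (by simpa using hlow)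
    have hne : digitVec b p k ⟨digitLen b k - 1, by omega⟩ ≠ 0 := by
      simp only [digitVec, natDigit, Nat.mod_eq_of_lt hq, ne_eq, ZMod.natCast_eq_zero_iff]
      exact fun hdvd => absurd (Nat.le_of_dvd (by omega) hdvd) (not_le.2 hq)
    have := lt_vWeight hne
    simp only at this
    omega

/-- Every block vector `A ∈ ℤ_b^p` is a truncated digit vector `tr_p(⃗k)`, `0 ≤ k < b^p`. [folklore] -/
private theorem exists_digitVec_eq (a : Fin p → ZMod b) : ∃ k, k < b ^ p ∧ digitVec b p k = a := by
  let f : Fin p → Fin b := fun r => ⟨(a r).val, ZMod.val_lt (a r)⟩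
  refine ⟨finFunctionFinEquiv f, (finFunctionFinEquiv f).2, funext fun r => ?_⟩
  have h : ((finFunctionFinEquiv.symm (finFunctionFinEquiv f) r : Fin b) : ℕ) =
      (finFunctionFinEquiv f : ℕ) / b ^ (r : ℕ) % b := finFunctionFinEquiv_symm_apply_val _ _
  rw [Equiv.symm_apply_apply] at h
  show ((natDigit b (finFunctionFinEquiv f : ℕ) r : ℕ) : ZMod b) = a r
  rw [natDigit, ← h]
  exact ZMod.natCast_zmod_val (a r)

/-- **Theorem 7.8 in terms of the dual net.** The matrices `C_1, …, C_s ∈ ℤ_b^{p × m}` (`p ≥ m - t`,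
`s ≥ 1`, `b ≥ 2`) generate a digital `(t, m, s)`-net (`0 ≤ t ≤ m`) if and only if every
`𝐤 ∈ 𝓓(C_1, …, C_s) ∖ {𝟎}` with `0 ≤ k_j < b^p` has NRT weight `Σ_j ℓ_j ≥ m - t + 1`, where `ℓ_j` is the
number of base-`b` digits of `k_j` (the digit form of `δ(𝒞^⊥) ≥ m - t + 1`, over the ring `ℤ_b`).
[cite: DickPillichshammer2010, Thm. 7.8] [cite: DickPillichshammer2010, Def. 4.76]
[cite: DickPillichshammer2010, Lemma 13.8] (proof: "`𝐜_1^{(1)}, …, 𝐜_{ℓ_1-1}^{(1)}, …` are linearly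
independent by the digital `(t, m, s)`-net property") -/
theorem isDigitalTMSNet_iff_dualNet [Nonempty ι] (hb : 1 < b) {t : ℕ}
    {C : ι → Matrix (Fin p) (Fin m) (ZMod b)} (hp : m ≤ p + t) :
    IsDigitalTMSNet t C ↔ t ≤ m ∧ ∀ k ∈ dualNet C, (∀ j, k j < b ^ p) → k ≠ 0 →
      m - t + 1 ≤ ∑ j, digitLen b (k j) := by
  have hd : m - t ≤ Fintype.card ι * p :=
    le_trans (by omega) (Nat.le_mul_of_pos_left p Fintype.card_pos)
  rw [isDigitalTMSNet_iff_isDSystem hp, isDSystem_iff_le_nrtWeight hd]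
  refine and_congr_right fun _ => ⟨fun h k hk hkp hk0 => ?_, fun h A hA hA0 => ?_⟩
  · have hw : nrtWeight (fun j => digitVec b p (k j)) = ∑ j, digitLen b (k j) :=
      Finset.sum_congr rfl fun j _ => vWeight_digitVec hb (hkp j)
    have hne : (fun j => digitVec b p (k j)) ≠ 0 := fun h0 => hk0 (funext fun j => by
      have := congrFun (congrArg (fun A : ι → Fin p → ZMod b => fun j => vWeight (A j)) h0) j
      simp only [vWeight_digitVec hb (hkp j), Pi.zero_apply, vWeight_zero] at this
      exact digitLen_eq_zero_iff'.1 this)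
    rw [← hw]
    exact h _ ((digitVec_mem_dualSpace_iff C k).2 hk) hne
  · choose k hkp hkA using fun j => exists_digitVec_eq (A j)
    have hA' : (fun j => digitVec b p (k j)) = A := funext hkA
    have hk : k ∈ dualNet C := (digitVec_mem_dualSpace_iff C k).1 (hA' ▸ hA)
    have hk0 : k ≠ 0 := by
      rintro rfl
      refine hA0 ?_
      rw [← hA']
      funext j r
      simp [digitVec, natDigit]
    have hw : nrtWeight A = ∑ j, digitLen b (k j) := by
      rw [← hA']
      exact Finset.sum_congr rfl fun j _ => vWeight_digitVec hb (hkp j)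
    rw [hw]
    exact h k hk hkp hk0

/-- **Theorem 7.8 in terms of the dual net, point form** (`b` prime): the digital point set of
`C_1, …, C_s ∈ ℤ_b^{p × m}` (`p ≥ m - t`, `s ≥ 1`) is a `(t, m, s)`-net in base `b` iff `t ≤ m` and
every `𝐤 ∈ 𝓓 ∖ {𝟎}` with `k_j < b^p` has `Σ_j ℓ_j ≥ m - t + 1`. [cite: DickPillichshammer2010, Thm. 7.8]
[cite: DickPillichshammer2010, Def. 4.76] -/
theorem isTMSNet_digitalNetPoint_iff_dualNet [Fact b.Prime] [Nonempty ι] {t : ℕ}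
    {C : ι → Matrix (Fin p) (Fin m) (ZMod b)} (hp : m ≤ p + t) :
    IsTMSNet b t m (digitalNetPoint C) ↔ t ≤ m ∧ ∀ k ∈ dualNet C, (∀ j, k j < b ^ p) → k ≠ 0 →
      m - t + 1 ≤ ∑ j, digitLen b (k j) := by
  rw [← isDigitalTMSNet_iff_isTMSNet, isDigitalTMSNet_iff_dualNet (Fact.out : b.Prime).one_lt hp]

end DualNet

end Literature.Analysis.Quadrature
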